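import Literature.RingTheory.TightClosure.TightClosure
import Mathlib.Algebra.CharP.Lemmas
import HarnessLib

/-!
# Tightly closed ⇒ Frobenius closed (inline clauses of route `FrobeniusLadder`)

Route `FrobeniusLadder`, crux `FRationalResolution` (stmt-ResolutionOfSingularities-15317), line
`Sketch`. Rung 3 of the ladder asks that the parameter ideals `I` of the (domain) stalks be TIGHTLY
CLOSED, in the inline form
`∀ y c, c ≠ 0 → (∀ e, c * y ^ (p ^ e) ∈ span {z ^ (p ^ e) | z ∈ I}) → y ∈ I`,
while rung 2 (crux `FInjectiveMacaulayfication`) asks, besides Cohen–Macaulayness, that they be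
FROBENIUS CLOSED, `∀ y, (∃ e, y ^ (p ^ e) ∈ span {z ^ (p ^ e) | z ∈ I}) → y ∈ I`.
This file records the ladder-consistency fact "tightly closed ⇒ Frobenius closed" for an ideal of a
domain of prime characteristic `p` (`frobeniusClosed_of_tightlyClosed_clause`) and its
system-of-parameters form: the F-rational stalk clause of the crux implies the Frobenius-closedness
half of rung 2's clause (`frobeniusClosed_sop_of_fRational_clause`).

Proof. The two inline clauses are literally `IsTightlyClosed p I` and `IsFrobeniusClosed p I` of
`Literature.RingTheory.TightClosure` (`isTightlyClosed_iff_of_isDomain`, `isFrobeniusClosed_iff`),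
and `I^F ⊆ I^*` (`IsTightlyClosed.isFrobeniusClosed`): if `y ^ q₀ ∈ I^[q₀]`, `q₀ = p ^ e₀`, then
`c := y ^ q₀` (or `c := 1` if `y = 0`) is a multiplier for every `q = p ^ e` — for `e ≤ e₀` because
`I^[q₀] ⊆ I^[q]`, and for `e = e₀ + j` because the Frobenius is additive in characteristic `p`, so
that `y ^ q = (y ^ q₀) ^ (p ^ j) ∈ (I^[q₀])^[p ^ j] = I^[q]`
[FedderWatanabe1989, Remark 1.9 (last sentence)].

The characteristic hypothesis `[CharP A p]` cannot be dropped: in `𝔽₃[s, t]` with `p = 2` and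
`I = (s², t²)` the tight-closure clause holds (for `q = 2 ^ e ≥ 3 ^ n` the characteristic-`3`
Frobenius gives `span {z ^ q | z ∈ I} ⊆ (s ^ (2·3^n), t ^ (2·3^n))`, and a lowest-degree-form
computation then excludes every multiplier `c ≠ 0` for every `y ∉ I`), whereas `y = s t ∉ I` has
`y ^ 2 = (s²)² + (t²)² - (s² + t²)² ∈ span {z ^ 2 | z ∈ I}`.
-/

-- single-problem summit: the doubled namespace component is forced
set_option linter.dupNamespace false

noncomputable section

open Literature.RingTheory.TightClosure

namespace Summit.ResolutionOfSingularities.ResolutionOfSingularities.Theorems.FRationalResolution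

/-- **Tightly closed ⇒ Frobenius closed, inline clauses.** Let `A` be a domain of prime
characteristic `p` and `I` an ideal such that `c ≠ 0 ∧ (∀ e, c * y ^ (p ^ e) ∈ span {z ^ (p ^ e) | z ∈ I})`
forces `y ∈ I`. Then `y ^ (p ^ e) ∈ span {z ^ (p ^ e) | z ∈ I}` for a single `e` already forces
`y ∈ I`. [cite: FedderWatanabe1989, Remark 1.9] -/
theorem frobeniusClosed_of_tightlyClosed_clause (p : ℕ) (hp : p.Prime) {A : Type} [CommRing A]
    [IsDomain A] [CharP A p] (I : Ideal A)
    (hI : ∀ y c : A, c ≠ 0 →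
      (∀ e : ℕ, c * y ^ p ^ e ∈ Ideal.span ((fun z : A => z ^ p ^ e) '' (I : Set A))) → y ∈ I) :
    ∀ y : A, (∃ e : ℕ, y ^ p ^ e ∈ Ideal.span ((fun z : A => z ^ p ^ e) '' (I : Set A))) →
      y ∈ I := by
  haveI : ExpChar A p := ExpChar.prime hp
  exact (isFrobeniusClosed_iff p).mp ((isTightlyClosed_iff_of_isDomain p).mpr hI).isFrobeniusClosed

/-- **The F-rational stalk clause implies the Frobenius-closedness half of rung 2.** If `A` is a
domain of prime characteristic `p` in which every ideal generated by a system of parameters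
(`dim A` elements `s` with `rad (s)` maximal) satisfies the inline tight-closure clause, then every
such ideal satisfies the inline Frobenius-closure clause
`(∃ e, y ^ (p ^ e) ∈ span {z ^ (p ^ e) | z ∈ (s)}) → y ∈ (s)`. [cite: FedderWatanabe1989, Remark 1.9] -/
theorem frobeniusClosed_sop_of_fRational_clause (p : ℕ) (hp : p.Prime) {A : Type} [CommRing A]
    [CharP A p]
    (hFR : IsDomain A ∧ ∀ d : ℕ, ringKrullDim A = d → ∀ s : Fin d → A,
      (Ideal.span (Set.range s)).radical.IsMaximal → ∀ y c : A, c ≠ 0 →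
        (∀ e : ℕ, c * y ^ p ^ e ∈ Ideal.span ((fun z : A => z ^ p ^ e) ''
          (Ideal.span (Set.range s) : Set A))) → y ∈ Ideal.span (Set.range s)) :
    ∀ d : ℕ, ringKrullDim A = d → ∀ s : Fin d → A, (Ideal.span (Set.range s)).radical.IsMaximal →
      ∀ y : A, (∃ e : ℕ, y ^ p ^ e ∈ Ideal.span ((fun z : A => z ^ p ^ e) ''
        (Ideal.span (Set.range s) : Set A))) → y ∈ Ideal.span (Set.range s) := by
  haveI := hFR.1
  exact fun d hd s hs => frobeniusClosed_of_tightlyClosed_clause p hp _ (hFR.2 d hd s hs)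

end Summit.ResolutionOfSingularities.ResolutionOfSingularities.Theorems.FRationalResolution
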